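import Mathlib
import HarnessLib
import Summits.HubbardSuperconductivity.HubbardSuperconductivity.Theorems.KLProgrammeKLRegimeSplitPhValueExchangeTransferWeighted
import Summits.HubbardSuperconductivity.HubbardSuperconductivity.Theorems.KLProgrammeKLRegimeSplitPhValueExchangeData

/-!
# Route `KLProgramme` — ENGINE (stmt-HubbardSuperconductivity-20437 `KLRegimeEngineV17F2`), row (c) binder #8 (★ v19 `hexLadMV`), the EXCHANGE p-h value row `RQ` at every pin,
# θ-RESOLVED AND TURNKEY: O6l-b with `G`, `εΦ`, `d_r`, `N_sh` DISCHARGED (O6l-a two-shift shell data, O6k-a band shift, O6h-c count) in the regime `8(2π/β + d_r) ≤ Λ(t)` — brick O6l-c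
# (cell gate-hubbard-kl, seat hubbard-kl-k3c2-p2 g32, technique «thermal-bar induction n ≤ nScales β + 1 with EngineBoundsAtV4S sums»)

WHY.  O6l-b `klph_exchangeRow_transfer_le_weighted` leaves the doubly shifted rung `G`, the member-symbol shift `εΦ`, the band shift `d_r` of `r = Qm − x − y` and the hard-shell count
`N_sh` as data.  Here: `d_r = (4 + ‖K‖₁)‖Qm − x − y‖_𝕋` (`klph_bandShift_le`); in the regime `8(2π/β + d_r) ≤ Λ(t)` (above the thermal layer AND near the exchange diagonal):
`G = 4/Λ(t)` (`klph_norm_propCT_shift2_le` with `klph_abs_shift_freq_sub_le` / `klph_abs_upShift_freq_sub_le`), `εΦ = (128/Λ(t)²)·((2π/β)(2Λ(t) + 2π/β) + d_r(2Λ(t) + d_r))`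
(`klph_memberSymbol_shift2_le`), `N_sh ≤ (Λ(t)β/π + 1)(2200·4Λₙ·L² + 200000·L)` (`klph_card_hardShell_le`, `2¹⁵ ≤ L`, `1 ≤ n`).

* **`klph_exchangeRow_transfer_le_weighted_regime`** — O6l-b's conclusion with these substitutions; the correction is thermal + LINEAR in `d_r` (O6h-f is `r = 0`); remaining data =
  E1's only + `F∞`.  By value (own digits, for the hands): the `d_r` part is O6k-c's (`≤ 2^{30.6}·(1 + π/(βΛ))·(d_r/Λ)·F∞`, one spin sum fewer), the thermal part O6h-f's.
  Outside the regime the row is O6j′ `klph_exchangeRow_signBlind_le`.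
Pure composition; no definitions; nothing asserts (c), K3 or superconductivity.  [cite: BenfattoGiulianiMastropietro2006, §2.5]
-/

noncomputable section

namespace Summit.HubbardSuperconductivity.HubbardSuperconductivity.Theorems.KLRegimeSplit

set_option linter.dupNamespace false -- summit = problem name (single-conjunct summit), D-0017

open Real Set Finset Literature.MathematicalPhysics.QuantumLattice
open Literature.Probability.LatticeModels hiding torusSupNorm
open Literature.MathematicalPhysics.QuantumLattice.BandSectorCounting
open Summit.HubbardSuperconductivity.HubbardSuperconductivity.Theorems.TwoPointAssembly
open Summit.HubbardSuperconductivity.HubbardSuperconductivity.Theorems.KLProgrammeLegKernels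
open Summit.HubbardSuperconductivity.HubbardSuperconductivity.Theorems.KLRegimeWick
open Summit.HubbardSuperconductivity.HubbardSuperconductivity.Theorems.EngineV8
open Summit.HubbardSuperconductivity.HubbardSuperconductivity.Theorems.DispersionFlow
open Summit.HubbardSuperconductivity.HubbardSuperconductivity.Theorems.PerturbedFermiCurve
open Summit.HubbardSuperconductivity.HubbardSuperconductivity.Theorems.C4a

variable {L M : ℕ} [NeZero L] [NeZero M]

section TransferRegime

variable {R : RenConsts} {U : ℝ} {N : ℕ}

/-- **THE EXCHANGE p-h ROW AT EVERY PIN, θ-RESOLVED, TURNKEY in the regime `8(2π/β + d_r) ≤ Λ(t)`** (module docstring). [cite: BenfattoGiulianiMastropietro2006, §2.5] -/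
theorem klph_exchangeRow_transfer_le_weighted_regime {β μ : ℝ} {K : TrigPolyC4v} (hK : FrameOK R U N μ K) (hβ : klBetaMin ≤ β) (hβL : β ≤ L)
    {a b : ℝ} (B : BandBounds a b) {A : ℝ} (hA : ∀ p : Momentum, ∀ j ≤ 2, ‖iteratedFDeriv ℝ j (frameShift K) p‖ ≤ A) (hADt : 2 * A < B.Dtmin)
    {r : ℝ} (hlo : a < μ - r - A) (hhi : μ + r + A < b) (n : ℕ) {t : ℝ} (ht : t ∈ Icc (0 : ℝ) 1)
    (Φ : ℕ → ℝ → FreqMomentum L M → ℝ) (hΦ : Φ = fun j t k => (softSymbolCompl L M β μ K (n + 1) j) k + (hubbardCutoffWeightCT L M β μ K (klScale klE0 (n + 1)) k -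
            hubbardCutoffWeightCT L M β μ K (klScale klE0 n + t * (klScale klE0 (n + 1) - klScale klE0 n)) k))
    (Wd : ℝ → FreqMomentum L M → ℝ) (hWd : Wd = fun t k => deriv (fun Λ' : ℝ => hubbardCutoffWeightCT L M β μ K Λ' k) (klScale klE0 n + t * (klScale klE0 (n + 1) - klScale klE0 n)))
    {j : ℕ} (hj : n + 1 ≤ j) (hΛr : klScale klE0 n + t * (klScale klE0 (n + 1) - klScale klE0 n) < r)
    (hM : β * (klScale klE0 n + t * (klScale klE0 (n + 1) - klScale klE0 n)) / (2 * Real.pi) + 1 ≤ M)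
    {Mg ℓ r₁ : ℝ} (hr₁ : 0 < r₁)
    (hbd : ∀ s, |klWd (klScale klE0 n + t * (klScale klE0 (n + 1) - klScale klE0 n)) s *
      klPhi (klScale klE0 j) (klScale klE0 n + t * (klScale klE0 (n + 1) - klScale klE0 n)) s| ≤ Mg)
    (hlip : ∀ s s', |klWd (klScale klE0 n + t * (klScale klE0 (n + 1) - klScale klE0 n)) s *
        klPhi (klScale klE0 j) (klScale klE0 n + t * (klScale klE0 (n + 1) - klScale klE0 n)) s -
      klWd (klScale klE0 n + t * (klScale klE0 (n + 1) - klScale klE0 n)) s' *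
        klPhi (klScale klE0 j) (klScale klE0 n + t * (klScale klE0 (n + 1) - klScale klE0 n)) s'| ≤ ℓ * |s - s'|)
    (hin : ∀ s, s ≤ r₁ ^ 2 → klWd (klScale klE0 n + t * (klScale klE0 (n + 1) - klScale klE0 n)) s *
      klPhi (klScale klE0 j) (klScale klE0 n + t * (klScale klE0 (n + 1) - klScale klE0 n)) s = 0)
    (hout : ∀ s, (klScale klE0 n + t * (klScale klE0 (n + 1) - klScale klE0 n)) ^ 2 ≤ s →
      klWd (klScale klE0 n + t * (klScale klE0 (n + 1) - klScale klE0 n)) s *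
        klPhi (klScale klE0 j) (klScale klE0 n + t * (klScale klE0 (n + 1) - klScale klE0 n)) s = 0)
    {σ τ : MatsubaraIdx M → MatsubaraIdx M}
    (hσ : ∀ ν : MatsubaraIdx M, (ν : ℕ) ≠ 0 → matsubaraInt M (σ ν) = matsubaraInt M ν - 1) (hσ0 : ∀ ν : MatsubaraIdx M, (ν : ℕ) = 0 → σ ν = ν)
    (hτ : ∀ ν : MatsubaraIdx M, (ν : ℕ) ≠ 2 * M - 1 → matsubaraInt M (τ ν) = matsubaraInt M ν + 1) (hτ0 : ∀ ν : MatsubaraIdx M, (ν : ℕ) = 2 * M - 1 → τ ν = ν)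
    (Qm x y : TorusSite 2 L) (F : FreqMomentum L M → FreqMomentum L M → ℂ) {Finf : ℝ} (hF0 : 0 ≤ Finf)
    -- the reference field and its window profile
    (V₀ : FreqMomentum L M → Fin 2 → ℂ) {ε : ℝ} (hε0' : 0 ≤ ε) {m : ℕ} (cen : Fin m → TorusSite 2 L) (ρw Aw : Fin m → ℝ) (hρw : ∀ w, 0 ≤ ρw w) (hAw : ∀ w, 0 ≤ Aw w)
    (hδ : ∀ p : FreqMomentum L M, Wd t p ≠ 0 →
      ‖F (τ p.1, p.2 - (Qm - x - y)) p - V₀ p 0‖ ≤ ε + ∑ w : Fin m, (if klTorusNorm L (p.2 - cen w) ≤ ρw w then Aw w else 0) ∧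
        ‖F p (σ p.1, p.2 + (Qm - x - y)) - V₀ p 1‖ ≤ ε + ∑ w : Fin m, (if klTorusNorm L (p.2 - cen w) ≤ ρw w then Aw w else 0))
    -- the angular weights of the reference field
    (w₁ w₂ : ℝ × ℝ → ℝ) (v₁ v₂ : ℝ → ℝ) (hvm₁ : Measurable v₁) (hvm₂ : Measurable v₂) (hvp₁ : Function.Periodic v₁ (2 * π)) (hvp₂ : Function.Periodic v₂ (2 * π))
    {Bv : ℝ} (hvb₁ : ∀ ϑ, |v₁ ϑ| ≤ Bv) (hvb₂ : ∀ ϑ, |v₂ ϑ| ≤ Bv)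
    (hw₁ : ∀ p : ℝ × ℝ, p.1 ∈ Ioo (-r) r → w₁ (levelChart μ K p) = v₁ p.2) (hw₂ : ∀ p : ℝ × ℝ, p.1 ∈ Ioo (-r) r → w₂ (levelChart μ K p) = v₂ p.2)
    (hwc₁ : Continuous w₁) (hwc₂ : Continuous w₂) (hw1₁ : ∀ x y, w₁ (x + 2 * π, y) = w₁ (x, y)) (hw2₁ : ∀ x y, w₁ (x, y + 2 * π) = w₁ (x, y))
    (hw1₂ : ∀ x y, w₂ (x + 2 * π, y) = w₂ (x, y)) (hw2₂ : ∀ x y, w₂ (x, y + 2 * π) = w₂ (x, y))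
    {Lw Bw : ℝ} (hLw : 0 ≤ Lw) (hwlip₁ : ∀ p q : ℝ × ℝ, |w₁ p - w₁ q| ≤ Lw * dist p q) (hwlip₂ : ∀ p q : ℝ × ℝ, |w₂ p - w₂ q| ≤ Lw * dist p q)
    (hwb₁ : ∀ p, |w₁ p| ≤ Bw) (hwb₂ : ∀ p, |w₂ p| ≤ Bw)
    (hV : ∀ p : FreqMomentum L M, ∑ s : Fin 2, V₀ p s =
      ((w₁ (latticeMomentum L p.2 0, latticeMomentum L p.2 1) : ℝ) : ℂ) + ((w₂ (latticeMomentum L p.2 0, latticeMomentum L p.2 1) : ℝ) : ℂ) * Complex.I)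
    (hF : ∀ p : FreqMomentum L M, Wd t p ≠ 0 → ‖F (τ p.1, p.2 - (Qm - x - y)) p‖ ≤ Finf ∧ ‖F p (σ p.1, p.2 + (Qm - x - y))‖ ≤ Finf)
    (h8 : 8 * (2 * π / β + ((4 + K.coeffNorm 1) * klTorusNorm L (Qm - x - y))) ≤ (klScale klE0 n + t * (klScale klE0 (n + 1) - klScale klE0 n))) (hL15 : (2 : ℝ) ^ 15 ≤ L) (hn1 : 1 ≤ n) :
    (klScale klE0 n - klScale klE0 (n + 1)) * ((β * (L : ℝ) ^ 2) ^ 3)⁻¹ *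
      ‖∑ p : FreqMomentum L M, ∑ p' : FreqMomentum L M,
        (if matsubaraInt M p'.1 + matsubaraInt M (omega0 M) + matsubaraInt M (omega0 M) + 1 = matsubaraInt M p.1 ∧ p'.2 = p.2 + Qm - x - y then
          (((((Φ j t p) : ℝ) : ℂ) * (((β * (L : ℝ) ^ 2 : ℝ) : ℂ) * propCT L M β μ K p)) * ((((Wd t p') : ℝ) : ℂ) * (((β * (L : ℝ) ^ 2 : ℝ) : ℂ) * propCT L M β μ K p')) +
            ((((Wd t p) : ℝ) : ℂ) * (((β * (L : ℝ) ^ 2 : ℝ) : ℂ) * propCT L M β μ K p)) * ((((Φ j t p') : ℝ) : ℂ) * (((β * (L : ℝ) ^ 2 : ℝ) : ℂ) * propCT L M β μ K p'))) *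
            F p p'
        else 0)‖ ≤
      (klScale klE0 n - klScale klE0 (n + 1)) * (2 *
        (((2 * π) ^ 2)⁻¹ * (Bv * (2 * π * (π * Real.sqrt 2 / (B.Dtmin - 2 * A)) *
              ((2 * (klScale klE0 n + t * (klScale klE0 (n + 1) - klScale klE0 n)) * (2 * (klScale klE0 n + t * (klScale klE0 (n + 1) - klScale klE0 n)) *
                (2 * (klScale klE0 n + t * (klScale klE0 (n + 1) - klScale klE0 n)) ^ 2 * (ℓ / r₁ ^ 4 + 2 * Mg / r₁ ^ 6) + (ℓ / r₁ ^ 2 + Mg / r₁ ^ 4)))) *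
                ((klScale klE0 n + t * (klScale klE0 (n + 1) - klScale klE0 n)) + 2 * Real.pi / β) / β) +
            β⁻¹ * (((klScale klE0 n + t * (klScale klE0 (n + 1) - klScale klE0 n)) * β / π + 1) *
              (2 * (klScale klE0 n + t * (klScale klE0 (n + 1) - klScale klE0 n)) *
                (2 * π * (1 / (B.Dtmin - 2 * A) ^ 2 + Real.pi * Real.sqrt 2 * (2 + 4 * A) / (B.Dtmin - 2 * A) ^ 3) *
                  (klScale klE0 n + t * (klScale klE0 (n + 1) - klScale klE0 n)) * (Mg / r₁ ^ 2)))))) +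
          ((klScale klE0 n + t * (klScale klE0 (n + 1) - klScale klE0 n)) / π + 3 / β) *
            (2 * π * (Bw * (2 * (klScale klE0 n + t * (klScale klE0 (n + 1) - klScale klE0 n)) *
              (2 * (klScale klE0 n + t * (klScale klE0 (n + 1) - klScale klE0 n)) ^ 2 * (ℓ / r₁ ^ 4 + 2 * Mg / r₁ ^ 6) + (ℓ / r₁ ^ 2 + Mg / r₁ ^ 4)) *
              (4 + 2 * A)) + Lw * (Mg / r₁ ^ 2)) / L))) +
        ((2 : ℝ) ^ 10 * 15367 * ε + ∑ w : Fin m, (2 : ℝ) ^ 10 * 15381 * (ρw w / π + ((L : ℝ))⁻¹) * Aw w) +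
        (klScale klE0 n - klScale klE0 (n + 1)) *
            (((klScale klE0 n + t * (klScale klE0 (n + 1) - klScale klE0 n)) * β / π + 1) * (2200 * (4 * klScale klE0 n) * (L : ℝ) ^ 2 + 200000 * L)) * (β * (L : ℝ) ^ 2)⁻¹ *
          ((128 / 3 / (klScale klE0 n + t * (klScale klE0 (n + 1) - klScale klE0 n)) ^ 2) *
            (2 * ((2 / (klScale klE0 n + t * (klScale klE0 (n + 1) - klScale klE0 n))) * ((2 * π / β + ((4 + K.coeffNorm 1) * klTorusNorm L (Qm - x - y))) * (4 / (klScale klE0 n + t * (klScale klE0 (n + 1) - klScale klE0 n))) +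
              (128 / (klScale klE0 n + t * (klScale klE0 (n + 1) - klScale klE0 n)) ^ 2 * ((2 * π / β) * (2 * (klScale klE0 n + t * (klScale klE0 (n + 1) - klScale klE0 n)) + 2 * π / β) + ((4 + K.coeffNorm 1) * klTorusNorm L (Qm - x - y)) * (2 * (klScale klE0 n + t * (klScale klE0 (n + 1) - klScale klE0 n)) + ((4 + K.coeffNorm 1) * klTorusNorm L (Qm - x - y))))))) * Finf)) := by
  have hβ0 : 0 < β := pos_of_klBetaMin_le hβ
  have hL : (0 : ℝ) < L := hβ0.trans_le hβL
  have hβL2 : 0 < β * (L : ℝ) ^ 2 := by positivity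
  have h10 := (klmf_klScale_succ_pos_le n).2
  have h1 := (klmf_klScale_succ_pos_le n).1
  have hmem := klws_affine_mem_Icc h10 ht
  set Λt : ℝ := klScale klE0 n + t * (klScale klE0 (n + 1) - klScale klE0 n) with hΛt_def
  have hΛt : 0 < Λt := h1.trans_le hmem.1
  have hdiff : 0 ≤ klScale klE0 n - klScale klE0 (n + 1) := by linarith
  have hq0 : 0 ≤ 2 * π / β := by positivity
  set dq : ℝ := (4 + K.coeffNorm 1) * klTorusNorm L (Qm - x - y) with hdq_def
  have hdq0 : 0 ≤ dq := by
    have h1' : 0 ≤ K.coeffNorm 1 := TrigPolyC4v.coeffNorm_nonneg 1 K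
    have h2' : 0 ≤ klTorusNorm L (Qm - x - y) := torusSupNorm_nonneg _
    positivity
  have hdq : ∀ k : TorusSite 2 L, |nambuXiCT L μ K (k - (Qm - x - y)) - nambuXiCT L μ K k| ≤ dq ∧ |nambuXiCT L μ K (k + (Qm - x - y)) - nambuXiCT L μ K k| ≤ dq :=
    fun k => ⟨(klph_bandShift_le (L := L) μ K k (Qm - x - y)).2, (klph_bandShift_le (L := L) μ K k (Qm - x - y)).1⟩
  -- the data of O6l-b from O6l-a
  have hG : ∀ p : FreqMomentum L M, Wd t p ≠ 0 →
      ‖propCT L M β μ K (τ p.1, p.2 - (Qm - x - y))‖ ≤ 4 / Λt ∧ ‖propCT L M β μ K (σ p.1, p.2 + (Qm - x - y))‖ ≤ 4 / Λt := by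
    intro p hp
    rw [hWd] at hp
    exact ⟨klph_norm_propCT_shift2_le β μ K hΛt hp (klph_abs_upShift_freq_sub_le hτ hβ0 hτ0 p.1) (hdq p.2).1 h8,
      klph_norm_propCT_shift2_le β μ K hΛt hp (klph_abs_shift_freq_sub_le hβ0 hσ hσ0 p.1) (hdq p.2).2 h8⟩
  have hΛj : 0 < klScale klE0 j := klth_klScale_pos j
  have hE0 : (0 : ℝ) ≤ klE0 := by norm_num [klE0]
  have hjle : klScale klE0 j ≤ Λt := (EngineV8.klScale_le_klScale hE0 hj).trans hmem.1
  have hε : ∀ p : FreqMomentum L M, Wd t p ≠ 0 →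
      |Φ j t (τ p.1, p.2 - (Qm - x - y)) - Φ j t p| ≤ 128 / Λt ^ 2 * ((2 * π / β) * (2 * Λt + 2 * π / β) + dq * (2 * Λt + dq)) ∧
        |Φ j t (σ p.1, p.2 + (Qm - x - y)) - Φ j t p| ≤ 128 / Λt ^ 2 * ((2 * π / β) * (2 * Λt + 2 * π / β) + dq * (2 * Λt + dq)) := by
    intro p hp
    rw [hWd] at hp
    rw [hΦ]
    exact ⟨klph_memberSymbol_shift2_le β μ K n j hΛj hjle hp hq0 hdq0 (klph_abs_upShift_freq_sub_le hτ hβ0 hτ0 p.1) (hdq p.2).1 h8,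
      klph_memberSymbol_shift2_le β μ K n j hΛj hjle hp hq0 hdq0 (klph_abs_shift_freq_sub_le hβ0 hσ hσ0 p.1) (hdq p.2).2 h8⟩
  have hmain := klph_exchangeRow_transfer_le_weighted (L := L) (M := M) hK hβ hβL B hA hADt hlo hhi n ht Φ hΦ Wd hWd hj hΛr hM hr₁ hbd hlip hin hout hσ hσ0 hτ hτ0
    Qm x y F hF0 (by positivity : (0 : ℝ) ≤ 4 / Λt) (by positivity : (0 : ℝ) ≤ 128 / Λt ^ 2 * ((2 * π / β) * (2 * Λt + 2 * π / β) + dq * (2 * Λt + dq))) hdq0 hdq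
    V₀ hε0' cen ρw Aw hρw hAw hδ w₁ w₂ v₁ v₂ hvm₁ hvm₂ hvp₁ hvp₂ hvb₁ hvb₂ hw₁ hw₂ hwc₁ hwc₂ hw1₁ hw2₁ hw1₂ hw2₂ hLw hwlip₁ hwlip₂ hwb₁ hwb₂ hV hF hG hε
  -- the count
  have hcard : ((univ.filter fun p : FreqMomentum L M => Wd t p ≠ 0).card : ℝ) ≤ (Λt * β / π + 1) * (2200 * (4 * klScale klE0 n) * (L : ℝ) ^ 2 + 200000 * L) := by
    have h := klph_card_hardShell_le (L := L) (M := M) hK hL15 hβ0 hn1 hΛt hmem.2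
    rw [hWd]
    exact h
  have hrest : 0 ≤ (β * (L : ℝ) ^ 2)⁻¹ * ((128 / 3 / Λt ^ 2) * (2 * ((2 / Λt) * ((2 * π / β + dq) * (4 / Λt) +
      128 / Λt ^ 2 * ((2 * π / β) * (2 * Λt + 2 * π / β) + dq * (2 * Λt + dq)))) * Finf)) := by
    positivity
  have hmono : (klScale klE0 n - klScale klE0 (n + 1)) * ((univ.filter fun p : FreqMomentum L M => Wd t p ≠ 0).card : ℝ) * (β * (L : ℝ) ^ 2)⁻¹ *
        ((128 / 3 / Λt ^ 2) * (2 * ((2 / Λt) * ((2 * π / β + dq) * (4 / Λt) +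
          128 / Λt ^ 2 * ((2 * π / β) * (2 * Λt + 2 * π / β) + dq * (2 * Λt + dq)))) * Finf)) ≤
      (klScale klE0 n - klScale klE0 (n + 1)) * ((Λt * β / π + 1) * (2200 * (4 * klScale klE0 n) * (L : ℝ) ^ 2 + 200000 * L)) * (β * (L : ℝ) ^ 2)⁻¹ *
        ((128 / 3 / Λt ^ 2) * (2 * ((2 / Λt) * ((2 * π / β + dq) * (4 / Λt) +
          128 / Λt ^ 2 * ((2 * π / β) * (2 * Λt + 2 * π / β) + dq * (2 * Λt + dq)))) * Finf)) := by
    have := mul_le_mul_of_nonneg_left hcard hdiff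
    have := mul_le_mul_of_nonneg_right this hrest
    simpa only [mul_assoc] using this
  linarith

end TransferRegime

end Summit.HubbardSuperconductivity.HubbardSuperconductivity.Theorems.KLRegimeSplit

end
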